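import Summits.RiemannHypothesis.RiemannHypothesis.Theorems.SemilocalNegCertSixtySevenKinked2137
import HarnessLib

/-!
# Semi-local threshold of the `{∞,2,…,67}` form, negative side: `a*({2,…,67}) ≤ 547 / 256 = 2.13671875` — the wall `q = 71` from a KINKED (piecewise-cubic) witness with slope breaks at the prime-atom images (part 15/27: the kernel facts piece 207 … piece 221 of 370 (imports part 1 only))

Cell `rh-explicit` (HOME `run/shared/lean/pub/rh-explicit/`), seat cc-s2-9 gen3 (HUMAN RULING D-0074 (D5) WEIL data engine; LADDER-RH column WEIL, rung DATA → W-P(P2);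
pipeline = cc-s2-4 gen8/gen11's piecewise-witness layer `SemilocalPiecewise{Witness,Increment,IncrementSum,Cert}.lean` + their float finder, every number
re-derived by an independent second engine E2 before filing; gen0/gen2 rows: `SemilocalNegCert{ThirteenKinked1423,…,FiftyThreeKinked2044}*`, capstone `SemilocalKinkedWallOffsets`).
HONEST FRAMING: RH-FREE theorems about the tree's `weilSemilocalThreshold S` of a TRUNCATED Weil form (finitely many places); nothing here bears on the
truth of RH; the lower clause `(log q)/2 ≤ a*(S_q)` at all primes IS RH and is untouched; the SIGN of `δ*(71)` is not claimed.

KINKED row for the wall `q = 71` (`S = {2,…,67}`): at `b = 547 / 256 = 2.13671875 ≈ a*(S_71) + 0.0054` (DATA, two engines, cc-s2-6/cc-s2-3: `a*(S_71) = 2.1313625`)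
the polynomial × indicator class is far from negative (tree row `549/256`, `SemilocalNegCertUptoSixtySeven`, `δ*(71) ≤ 0.0132`), whereas an odd piecewise cubic with slope breaks at the images
`|b − log n|` (rounded to `/1024`) of the atoms `n ∈ {3,5,7,11,13,17,19,23,29,31,37,41,43,47,53,59,61,67}` (the odd-prime atoms; all atom images resp. all primes resp. primes + 4 + 9 scanned, kit j257393) is negative by `3.032e-03·‖G‖²`.
Instance: `S = {2, 3, 5, 7, 11, 13, 17, 19, 23, 29, 31, 37, 41, 43, 47, 53, 59, 61, 67}`, `N = 75` (atom table `atomsUptoSixtySeven` / `atomsEnclose_UptoSixtySeven` of `SemilocalNegCertUptoSixtySeven.lean`), 19 pieces of degree ≤ 3, 370 `t`-pieces;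
TWO ENGINES on the witness before the kernel: cc-s2-4's float finder `λ_min = -3.0323e-03` and the seat's exact-in-`x` decimal engine E2 `R = -3.0396e-03` (no polar credit);
the exact kernel margin is the certificate's own rational arithmetic (farm report).  ⇒ **`a*({2,…,67}) ≤ 547 / 256`, `δ*(71) < 0.005379`** (was `0.0132`).
No data is trusted: every bound is a `decide +kernel` fact.  Folklore throughout.
-/

set_option autoImplicit false
set_option linter.dupNamespace false  -- the mandated namespace repeats `RiemannHypothesis`
set_option Elab.async false  -- serialise the kernel facts: in parallel they exhaust the node's per-process heap (cc-s2-4 gen11, CC4-LEAN §16.10)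

noncomputable section

open Complex Filter Set MeasureTheory Topology
open scoped Real

namespace Summit.RiemannHypothesis.RiemannHypothesis.Theorems.SemilocalPolyWitness

open MeasureTheory Set Finset Real
open Literature.NumberTheory.LFunctions
open Summit.RiemannHypothesis.RiemannHypothesis.Theorems.MotivicDoor
open Summit.RiemannHypothesis.RiemannHypothesis.Theorems.MotivicDoor.SemilocalThreshold
open Summit.RiemannHypothesis.RiemannHypothesis.Theorems.MotivicDoor.SemilocalMarkov
open LQ

set_option maxHeartbeats 0 in
/-- kernel fact: piece `207` of `certSixtySevenKinked2137`. -/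
theorem check_SixtySevenKinked2137_piece207 : certSixtySevenKinked2137.checkPiecePW 207 = true := by
  decide +kernel

set_option maxHeartbeats 0 in
/-- kernel fact: piece `208` of `certSixtySevenKinked2137`. -/
theorem check_SixtySevenKinked2137_piece208 : certSixtySevenKinked2137.checkPiecePW 208 = true := by
  decide +kernel

set_option maxHeartbeats 0 in
/-- kernel fact: piece `209` of `certSixtySevenKinked2137`. -/
theorem check_SixtySevenKinked2137_piece209 : certSixtySevenKinked2137.checkPiecePW 209 = true := by
  decide +kernel

set_option maxHeartbeats 0 in
/-- kernel fact: piece `210` of `certSixtySevenKinked2137`. -/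
theorem check_SixtySevenKinked2137_piece210 : certSixtySevenKinked2137.checkPiecePW 210 = true := by
  decide +kernel

set_option maxHeartbeats 0 in
/-- kernel fact: piece `211` of `certSixtySevenKinked2137`. -/
theorem check_SixtySevenKinked2137_piece211 : certSixtySevenKinked2137.checkPiecePW 211 = true := by
  decide +kernel

set_option maxHeartbeats 0 in
/-- kernel fact: piece `212` of `certSixtySevenKinked2137`. -/
theorem check_SixtySevenKinked2137_piece212 : certSixtySevenKinked2137.checkPiecePW 212 = true := by
  decide +kernel

set_option maxHeartbeats 0 in
/-- kernel fact: piece `213` of `certSixtySevenKinked2137`. -/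
theorem check_SixtySevenKinked2137_piece213 : certSixtySevenKinked2137.checkPiecePW 213 = true := by
  decide +kernel

set_option maxHeartbeats 0 in
/-- kernel fact: piece `214` of `certSixtySevenKinked2137`. -/
theorem check_SixtySevenKinked2137_piece214 : certSixtySevenKinked2137.checkPiecePW 214 = true := by
  decide +kernel

set_option maxHeartbeats 0 in
/-- kernel fact: piece `215` of `certSixtySevenKinked2137`. -/
theorem check_SixtySevenKinked2137_piece215 : certSixtySevenKinked2137.checkPiecePW 215 = true := by
  decide +kernel

set_option maxHeartbeats 0 in
/-- kernel fact: piece `216` of `certSixtySevenKinked2137`. -/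
theorem check_SixtySevenKinked2137_piece216 : certSixtySevenKinked2137.checkPiecePW 216 = true := by
  decide +kernel

set_option maxHeartbeats 0 in
/-- kernel fact: piece `217` of `certSixtySevenKinked2137`. -/
theorem check_SixtySevenKinked2137_piece217 : certSixtySevenKinked2137.checkPiecePW 217 = true := by
  decide +kernel

set_option maxHeartbeats 0 in
/-- kernel fact: piece `218` of `certSixtySevenKinked2137`. -/
theorem check_SixtySevenKinked2137_piece218 : certSixtySevenKinked2137.checkPiecePW 218 = true := by
  decide +kernel

set_option maxHeartbeats 0 in
/-- kernel fact: piece `219` of `certSixtySevenKinked2137`. -/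
theorem check_SixtySevenKinked2137_piece219 : certSixtySevenKinked2137.checkPiecePW 219 = true := by
  decide +kernel

set_option maxHeartbeats 0 in
/-- kernel fact: piece `220` of `certSixtySevenKinked2137`. -/
theorem check_SixtySevenKinked2137_piece220 : certSixtySevenKinked2137.checkPiecePW 220 = true := by
  decide +kernel

set_option maxHeartbeats 0 in
/-- kernel fact: piece `221` of `certSixtySevenKinked2137`. -/
theorem check_SixtySevenKinked2137_piece221 : certSixtySevenKinked2137.checkPiecePW 221 = true := by
  decide +kernel

end Summit.RiemannHypothesis.RiemannHypothesis.Theorems.SemilocalPolyWitness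

end
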